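import Summits.Ventures.LatticeQCDFlow.Exactness.Phi4MetropolisStepLawComparison
import HarnessLib

/-!
# Peskun's theorem for the local arm: among all acceptance rules for the same single-site proposal, the Metropolis rule `min(1, e^{−ΔS})` minimises the autocorrelations of EVERY observable

HONEST FRAMING: exact (Metropolis-corrected) sampling algorithms for lattice gauge theory;
figures of merit are autocorrelation/cost numbers at stated couplings and volumes; no
continuum-physics claim.  (SCALAR calibration rung S0-A: not a gauge result.)

Venture `LatticeQCDFlow` (cell pub-lqcd), topic `Exactness`; FANOUT row 2 (`s0-phi4`, LOCAL arm).
NEW WORK of the cell: the local-arm instance of PESKUN'S THEOREM proper, through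
`Exactness/Phi4MetropolisStepLawComparison.lean` (carré-du-champ domination ⇒ Dirichlet domination)
and `Exactness/ReversibleComparison.lean` (Dirichlet domination ⇒ ordered Abel sums / `τ_int`).
Nothing is cited as a fact.  Printed counterparts NAMED ONLY: Peskun 1973 (Biometrika 60) — for a
fixed proposal the Metropolis acceptance dominates every other acceptance rule satisfying detailed
balance (Barker's `t/(1+t)` included) in asymptotic variance, finite state space; Liu, *Monte Carlo
Strategies in Scientific Computing*, Thm 13.3.2; Tierney 1998 (general state space).  Here: lattice
φ⁴ on `ℝ^V` (every `λ > 0`, real `J`), the random-site scan with ANY even step law with all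
moments, EVERY observable of `PolyObs` (the magnetisation and the action included), Abel form
without summability — and no competing acceptance operator is constructed: the competitor is ANY
operator `K'` of the single-site form with an acceptance function `acc ∈ [0, 1]` obeying detailed
balance, assumed to be an exact reversible sampler on `PolyObs` in the `RevOp` sense (hypotheses).

## What is proved

* **`accept_le_metroAccept`** — detailed balance `acc(φ → φ') e^{−S(φ)} = acc(φ' → φ) e^{−S(φ')}`
  and `acc ≤ 1` force `acc(φ → φ') ≤ min(1, e^{−S(φ')}/e^{−S(φ)})` pointwise: the Metropolis rule
  accepts at least as often as any valid rule, move by move;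
* `accSite_carre_le`, **`accScan_carre_le_metroScan`** — hence the carré du champ of every
  `v ∈ PolyObs` under `K'` is pointwise below that under the Metropolis scan;
* **`metropolis_abelSum_le_of_acceptance`** (unconditional) — for every `g ∈ PolyObs`, `0 ≤ r < 1`:
  `Σ_k C_{g,Metropolis}(k) rᵏ ≤ Σ_k C_{g,K'}(k) rᵏ`;
* **`metropolis_tauInt_le_of_acceptance`** — under the standing summability hypothesis for both
  chains: **`τ_int,Metropolis(f) ≤ τ_int,K'(f)`** for every `f ∈ PolyObs`.

NOT CLAIMED: construction of a Barker (or any other) operator on `ℝ^V` and verification of its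
`RevOp` hypotheses (they are assumed of `K'`); multi-proposal / delayed-rejection rules (not of the
single-acceptance form); the ordered sweep; any number for any run.
-/

namespace Summit.Ventures.LatticeQCDFlow.Exactness

open Real MeasureTheory Filter Finset
open Summit.Ventures.LatticeQCDFlow.Scoring

section Lattice

variable {n : ℕ}

/-- **The Metropolis rule accepts at least as often as any acceptance rule in detailed balance with
the same symmetric proposal**: `0 ≤ acc ≤ 1` and `acc(φ→φ') w(φ) = acc(φ'→φ) w(φ')` (`w > 0`) give
`acc(φ→φ') ≤ min(1, w(φ')/w(φ))`. -/
theorem accept_le_metroAccept (J : Fin (n + 1) → Fin (n + 1) → ℝ) (lam : ℝ)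
    {acc : Fin (n + 1) → (Fin (n + 1) → ℝ) → ℝ → ℝ}
    (hacc1 : ∀ x φ t', acc x φ t' ≤ 1)
    (haccDB : ∀ x φ t', acc x φ t' * gibbsWeight J lam φ
      = acc x (Function.update φ x t') (φ x) * gibbsWeight J lam (Function.update φ x t'))
    (x : Fin (n + 1)) (φ : Fin (n + 1) → ℝ) (t' : ℝ) :
    acc x φ t' ≤ metroAccept J lam x φ t' := by
  unfold metroAccept
  have hw := gibbsWeight_pos J lam φ
  have hw' := gibbsWeight_pos J lam (Function.update φ x t')
  refine le_min (hacc1 x φ t') ?_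
  rw [le_div_iff₀ hw, haccDB x φ t']
  calc acc x (Function.update φ x t') (φ x) * gibbsWeight J lam (Function.update φ x t')
      ≤ 1 * gibbsWeight J lam (Function.update φ x t') :=
        mul_le_mul_of_nonneg_right (hacc1 _ _ _) hw'.le
    _ = gibbsWeight J lam (Function.update φ x t') := one_mul _

/-- **One site**: for a nonnegative `G ∈ PolyObs` with `G φ = 0`, the acceptance-`acc` hit of `G` at
`φ` is at most the Metropolis hit (the integrand is `acc · G(φ^{t'}) · ρ ≤ a_M · G(φ^{t'}) · ρ`). -/
theorem accSite_carre_le (J : Fin (n + 1) → Fin (n + 1) → ℝ) (lam : ℝ)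
    {ρ : ℝ → ℝ} (hρ0 : ∀ u, 0 ≤ ρ u) (hρm : Measurable ρ)
    (hρmom : ∀ j : ℕ, Integrable (fun u => (1 + |u|) ^ j * ρ u))
    {acc : Fin (n + 1) → (Fin (n + 1) → ℝ) → ℝ → ℝ}
    (hacc0 : ∀ x φ t', 0 ≤ acc x φ t') (hacc1 : ∀ x φ t', acc x φ t' ≤ 1)
    (haccDB : ∀ x φ t', acc x φ t' * gibbsWeight J lam φ
      = acc x (Function.update φ x t') (φ x) * gibbsWeight J lam (Function.update φ x t'))
    (x : Fin (n + 1)) {G : (Fin (n + 1) → ℝ) → ℝ} (hG : PolyObs G) (hG0 : ∀ ψ, 0 ≤ G ψ)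
    (φ : Fin (n + 1) → ℝ) (hGφ : G φ = 0) :
    ∫ t', (acc x φ t' * G (Function.update φ x t') + (1 - acc x φ t') * G φ) * ρ (t' - φ x)
      ≤ metroSite J lam ρ x G φ := by
  obtain ⟨hGm, B, k, hGb⟩ := hG
  have hI := (integrable_metroSite_integrand_poly J lam hρ0 hρm (hρmom (2 * k)) x hGm
    (abs_nonneg B) (abs_le_abs_mul_env hGb) φ).1
  unfold metroSite
  refine integral_mono_of_nonneg (Eventually.of_forall fun t' => ?_) hI
    (Eventually.of_forall fun t' => ?_)
  · exact mul_nonneg (add_nonneg (mul_nonneg (hacc0 _ _ _) (hG0 _))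
      (mul_nonneg (sub_nonneg.2 (hacc1 _ _ _)) (hG0 _))) (hρ0 _)
  · show (acc x φ t' * G (Function.update φ x t') + (1 - acc x φ t') * G φ) * ρ (t' - φ x)
      ≤ (metroAccept J lam x φ t' * G (Function.update φ x t')
          + (1 - metroAccept J lam x φ t') * G φ) * ρ (t' - φ x)
    rw [hGφ, mul_zero, mul_zero, add_zero, add_zero]
    exact mul_le_mul_of_nonneg_right
      (mul_le_mul_of_nonneg_right (accept_le_metroAccept J lam hacc1 haccDB x φ t') (hG0 _)) (hρ0 _)

/-- **The scan**: the carré du champ of `v ∈ PolyObs` under ANY single-site-form operator `K'` with a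
valid acceptance rule is pointwise below that under the Metropolis scan:
`K'[(v − v(φ))²](φ) ≤ K_M[(v − v(φ))²](φ)`. -/
theorem accScan_carre_le_metroScan (J : Fin (n + 1) → Fin (n + 1) → ℝ) (lam : ℝ)
    {ρ : ℝ → ℝ} (hρ0 : ∀ u, 0 ≤ ρ u) (hρm : Measurable ρ)
    (hρmom : ∀ j : ℕ, Integrable (fun u => (1 + |u|) ^ j * ρ u))
    {acc : Fin (n + 1) → (Fin (n + 1) → ℝ) → ℝ → ℝ}
    (hacc0 : ∀ x φ t', 0 ≤ acc x φ t') (hacc1 : ∀ x φ t', acc x φ t' ≤ 1)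
    (haccDB : ∀ x φ t', acc x φ t' * gibbsWeight J lam φ
      = acc x (Function.update φ x t') (φ x) * gibbsWeight J lam (Function.update φ x t'))
    {K' : ((Fin (n + 1) → ℝ) → ℝ) → ((Fin (n + 1) → ℝ) → ℝ)}
    (hK' : ∀ f φ, K' f φ = (∑ x, ∫ t', (acc x φ t' * f (Function.update φ x t')
      + (1 - acc x φ t') * f φ) * ρ (t' - φ x)) / ((n : ℝ) + 1))
    {v : (Fin (n + 1) → ℝ) → ℝ} (hv : PolyObs v) (φ : Fin (n + 1) → ℝ) :
    K' (fun y => (v y - v φ) ^ 2) φ ≤ 1 * metroScan J lam ρ (fun y => (v y - v φ) ^ 2) φ := by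
  have hn : (0 : ℝ) < (n : ℝ) + 1 := by positivity
  have hG : PolyObs (fun y => (v y - v φ) ^ 2) := by
    have h := polyObs_add_mul hv (polyObs_const 1) (-(v φ))
    have e : (fun ψ => v ψ + -(v φ) * (1 : ℝ)) = fun y => v y - v φ := funext fun ψ => by ring
    rw [e] at h
    exact polyObs_sq h
  rw [one_mul, hK']
  unfold metroScan
  exact div_le_div_of_nonneg_right (Finset.sum_le_sum fun x _ =>
    accSite_carre_le J lam hρ0 hρm hρmom hacc0 hacc1 haccDB x hG (fun _ => sq_nonneg _) φ
      (by simp)) hn.le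

/-- `K' 1 = 1` for the single-site form (translation invariance of `∫ ρ(t' − φ_x) dt' = 1`). -/
theorem accScan_one {ρ : ℝ → ℝ} (hρ1 : ∫ u, ρ u = 1)
    {acc : Fin (n + 1) → (Fin (n + 1) → ℝ) → ℝ → ℝ}
    {K' : ((Fin (n + 1) → ℝ) → ℝ) → ((Fin (n + 1) → ℝ) → ℝ)}
    (hK' : ∀ f φ, K' f φ = (∑ x, ∫ t', (acc x φ t' * f (Function.update φ x t')
      + (1 - acc x φ t') * f φ) * ρ (t' - φ x)) / ((n : ℝ) + 1)) (φ : Fin (n + 1) → ℝ) :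
    K' (fun _ => (1 : ℝ)) φ = 1 := by
  have hn : (0 : ℝ) < (n : ℝ) + 1 := by positivity
  rw [hK']
  have e : ∀ x : Fin (n + 1), ∫ t', (acc x φ t' * (1 : ℝ) + (1 - acc x φ t') * 1) * ρ (t' - φ x) = 1 := by
    intro x
    have e1 : ∀ t', (acc x φ t' * (1 : ℝ) + (1 - acc x φ t') * 1) * ρ (t' - φ x) = ρ (t' - φ x) :=
      fun t' => by ring
    simp_rw [e1]
    rw [integral_sub_right_eq_self ρ (φ x)]
    exact hρ1
  simp_rw [e]
  rw [Finset.sum_const, Finset.card_univ, Fintype.card_fin, nsmul_eq_mul, mul_one]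
  push_cast
  exact div_self hn.ne'

/-- **PESKUN'S THEOREM FOR THE LOCAL ARM, ABEL FORM (unconditional).**  Lattice φ⁴ with a coercive
action; `ρ` an even step density with all moments; `K_M = metroScan J λ ρ` the Metropolis scan;
`K'` ANY operator of the single-site form with an acceptance rule `acc ∈ [0,1]` in detailed balance
with `e^{−S}`, which is an exact reversible sampler on `PolyObs` ((stab), (lin), (symm), (contr)
assumed).  Then for every `g ∈ PolyObs` and `0 ≤ r < 1`:
`Σ_k C_{g,M}(k) rᵏ ≤ Σ_k C_{g,K'}(k) rᵏ`. -/
theorem metropolis_abelSum_le_of_acceptance {J : Fin (n + 1) → Fin (n + 1) → ℝ} {lam ε K : ℝ}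
    (hε : 0 < ε) (hS : ∀ φ : Fin (n + 1) → ℝ, ε * ∑ w, φ w ^ 2 - K ≤ latticePhi4Action J lam φ)
    {ρ : ℝ → ℝ} (hρ0 : ∀ u, 0 ≤ ρ u) (hρm : Measurable ρ) (hρi : Integrable ρ)
    (hρ1 : ∫ u, ρ u = 1) (hρs : ∀ u, ρ (-u) = ρ u)
    (hρmom : ∀ j : ℕ, Integrable (fun u => (1 + |u|) ^ j * ρ u))
    {acc : Fin (n + 1) → (Fin (n + 1) → ℝ) → ℝ → ℝ}
    (hacc0 : ∀ x φ t', 0 ≤ acc x φ t') (hacc1 : ∀ x φ t', acc x φ t' ≤ 1)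
    (haccDB : ∀ x φ t', acc x φ t' * gibbsWeight J lam φ
      = acc x (Function.update φ x t') (φ x) * gibbsWeight J lam (Function.update φ x t'))
    {K' : ((Fin (n + 1) → ℝ) → ℝ) → ((Fin (n + 1) → ℝ) → ℝ)}
    (hK' : ∀ f φ, K' f φ = (∑ x, ∫ t', (acc x φ t' * f (Function.update φ x t')
      + (1 - acc x φ t') * f φ) * ρ (t' - φ x)) / ((n : ℝ) + 1))
    (hAK' : ∀ ⦃f : (Fin (n + 1) → ℝ) → ℝ⦄, PolyObs f → PolyObs (K' f))
    (hlin' : ∀ ⦃f h : (Fin (n + 1) → ℝ) → ℝ⦄ (c : ℝ), PolyObs f → PolyObs h →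
      ∀ x, K' (fun s => f s + c * h s) x = K' f x + c * K' h x)
    (hsymm' : ∀ ⦃f h : (Fin (n + 1) → ℝ) → ℝ⦄, PolyObs f → PolyObs h →
      ∫ x, K' f x * h x * gibbsWeight J lam x = ∫ x, f x * K' h x * gibbsWeight J lam x)
    (hcontr' : ∀ ⦃f : (Fin (n + 1) → ℝ) → ℝ⦄, PolyObs f →
      ∫ x, K' f x ^ 2 * gibbsWeight J lam x ≤ ∫ x, f x ^ 2 * gibbsWeight J lam x)
    {g : (Fin (n + 1) → ℝ) → ℝ} (hg : PolyObs g) {r : ℝ} (hr0 : 0 ≤ r) (hr1 : r < 1) :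
    ∑' k, (∫ φ, g φ * ((metroScan J lam ρ)^[k] g) φ * gibbsWeight J lam φ) * r ^ k
      ≤ ∑' k, (∫ φ, g φ * (K'^[k] g) φ * gibbsWeight J lam φ) * r ^ k := by
  exact RevOp.abelSum_le_of_dirichlet_le (μ := volume) (A := PolyObs)
    (K := K') (K' := metroScan J lam ρ) (w := gibbsWeight J lam)
    (fun φ => (gibbsWeight_pos J lam φ).le)
    (fun f h hf hh => polyObs_integrable_mul_mul_gibbsWeight hε hS hf hh)
    (fun f h c hf hh => polyObs_add_mul hf hh c)
    hAK' hlin' hsymm' hcontr'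
    (fun f hf => polyObs_metroScan J lam hρ0 hρm hρmom hf)
    (fun f h c hf hh x => metroScan_add_mul_poly J lam hρ0 hρm hρmom hf hh c x)
    (fun f h hf hh => metroScan_reversible_poly hε hS hρ0 hρm hρi hρ1 hρs hρmom hf hh)
    (fun f hf => metroScan_contraction_poly hε hS hρ0 hρm hρi hρ1 hρs hρmom hf)
    (fun v hv => by
      have h := RevOp.dirichlet_le_mul_of_carre_le (μ := volume) (A := PolyObs)
        (K := K') (K' := metroScan J lam ρ) (w := gibbsWeight J lam)
        (fun φ => (gibbsWeight_pos J lam φ).le) (polyObs_const 1)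
        (fun f h hf hh => polyObs_integrable_mul_mul_gibbsWeight hε hS hf hh)
        (fun f h c hf hh => polyObs_add_mul hf hh c)
        hAK' hlin' hsymm' (fun φ => accScan_one hρ1 hK' φ)
        (fun f hf => polyObs_metroScan J lam hρ0 hρm hρmom hf)
        (fun f h c hf hh x => metroScan_add_mul_poly J lam hρ0 hρm hρmom hf hh c x)
        (fun f h hf hh => metroScan_reversible_poly hε hS hρ0 hρm hρi hρ1 hρs hρmom hf hh)
        (fun φ => metroScan_one J lam hρ1 φ)
        hv (polyObs_sq hv)
        (fun φ => accScan_carre_le_metroScan J lam hρ0 hρm hρmom hacc0 hacc1 haccDB hK' hv φ)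
      rw [one_mul] at h
      exact h)
    hg hr0 hr1

/-- **PESKUN'S THEOREM FOR THE LOCAL ARM (`τ_int`).**  Same setting; `f ∈ PolyObs` with `Var f > 0`,
`g = f − ⟨f⟩`, normalised autocorrelation series summable under both scans (proposal units).
Then  `τ_int,Metropolis(f) ≤ τ_int,K'(f)`. -/
theorem metropolis_tauInt_le_of_acceptance {J : Fin (n + 1) → Fin (n + 1) → ℝ} {lam ε K : ℝ}
    (hε : 0 < ε) (hS : ∀ φ : Fin (n + 1) → ℝ, ε * ∑ w, φ w ^ 2 - K ≤ latticePhi4Action J lam φ)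
    {ρ : ℝ → ℝ} (hρ0 : ∀ u, 0 ≤ ρ u) (hρm : Measurable ρ) (hρi : Integrable ρ)
    (hρ1 : ∫ u, ρ u = 1) (hρs : ∀ u, ρ (-u) = ρ u)
    (hρmom : ∀ j : ℕ, Integrable (fun u => (1 + |u|) ^ j * ρ u))
    {acc : Fin (n + 1) → (Fin (n + 1) → ℝ) → ℝ → ℝ}
    (hacc0 : ∀ x φ t', 0 ≤ acc x φ t') (hacc1 : ∀ x φ t', acc x φ t' ≤ 1)
    (haccDB : ∀ x φ t', acc x φ t' * gibbsWeight J lam φ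
      = acc x (Function.update φ x t') (φ x) * gibbsWeight J lam (Function.update φ x t'))
    {K' : ((Fin (n + 1) → ℝ) → ℝ) → ((Fin (n + 1) → ℝ) → ℝ)}
    (hK' : ∀ f φ, K' f φ = (∑ x, ∫ t', (acc x φ t' * f (Function.update φ x t')
      + (1 - acc x φ t') * f φ) * ρ (t' - φ x)) / ((n : ℝ) + 1))
    (hAK' : ∀ ⦃f : (Fin (n + 1) → ℝ) → ℝ⦄, PolyObs f → PolyObs (K' f))
    (hlin' : ∀ ⦃f h : (Fin (n + 1) → ℝ) → ℝ⦄ (c : ℝ), PolyObs f → PolyObs h →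
      ∀ x, K' (fun s => f s + c * h s) x = K' f x + c * K' h x)
    (hsymm' : ∀ ⦃f h : (Fin (n + 1) → ℝ) → ℝ⦄, PolyObs f → PolyObs h →
      ∫ x, K' f x * h x * gibbsWeight J lam x = ∫ x, f x * K' h x * gibbsWeight J lam x)
    (hcontr' : ∀ ⦃f : (Fin (n + 1) → ℝ) → ℝ⦄, PolyObs f →
      ∫ x, K' f x ^ 2 * gibbsWeight J lam x ≤ ∫ x, f x ^ 2 * gibbsWeight J lam x)
    {f : (Fin (n + 1) → ℝ) → ℝ} (hf : PolyObs f)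
    (hP : 0 < ∫ φ, (f φ - gibbsExpect J lam f) ^ 2 * gibbsWeight J lam φ)
    (hsK : Summable fun k => (∫ φ, (f φ - gibbsExpect J lam f)
        * (K'^[k + 1] (fun ψ => f ψ - gibbsExpect J lam f)) φ * gibbsWeight J lam φ)
        / ∫ φ, (f φ - gibbsExpect J lam f) ^ 2 * gibbsWeight J lam φ)
    (hsM : Summable fun k => (∫ φ, (f φ - gibbsExpect J lam f)
        * ((metroScan J lam ρ)^[k + 1] (fun ψ => f ψ - gibbsExpect J lam f)) φ * gibbsWeight J lam φ)
        / ∫ φ, (f φ - gibbsExpect J lam f) ^ 2 * gibbsWeight J lam φ) :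
    tauInt (fun k => (∫ φ, (f φ - gibbsExpect J lam f)
          * ((metroScan J lam ρ)^[k] (fun ψ => f ψ - gibbsExpect J lam f)) φ * gibbsWeight J lam φ)
          / ∫ φ, (f φ - gibbsExpect J lam f) ^ 2 * gibbsWeight J lam φ)
      ≤ tauInt (fun k => (∫ φ, (f φ - gibbsExpect J lam f)
          * (K'^[k] (fun ψ => f ψ - gibbsExpect J lam f)) φ * gibbsWeight J lam φ)
          / ∫ φ, (f φ - gibbsExpect J lam f) ^ 2 * gibbsWeight J lam φ) := by
  have hg : PolyObs (fun ψ => f ψ - gibbsExpect J lam f) := by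
    have h := polyObs_add_mul hf (polyObs_const 1) (-gibbsExpect J lam f)
    have e : (fun φ => f φ + -gibbsExpect J lam f * (1 : ℝ)) = fun ψ => f ψ - gibbsExpect J lam f :=
      funext fun φ => by ring
    rw [e] at h
    exact h
  exact RevOp.tauInt_le_of_dirichlet_le (μ := volume) (A := PolyObs)
    (K := K') (K' := metroScan J lam ρ) (w := gibbsWeight J lam)
    (fun φ => (gibbsWeight_pos J lam φ).le)
    (fun f h hf hh => polyObs_integrable_mul_mul_gibbsWeight hε hS hf hh)
    (fun f h c hf hh => polyObs_add_mul hf hh c)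
    hAK' hlin' hsymm' hcontr'
    (fun f hf => polyObs_metroScan J lam hρ0 hρm hρmom hf)
    (fun f h c hf hh x => metroScan_add_mul_poly J lam hρ0 hρm hρmom hf hh c x)
    (fun f h hf hh => metroScan_reversible_poly hε hS hρ0 hρm hρi hρ1 hρs hρmom hf hh)
    (fun v hv => by
      have h := RevOp.dirichlet_le_mul_of_carre_le (μ := volume) (A := PolyObs)
        (K := K') (K' := metroScan J lam ρ) (w := gibbsWeight J lam)
        (fun φ => (gibbsWeight_pos J lam φ).le) (polyObs_const 1)
        (fun f h hf hh => polyObs_integrable_mul_mul_gibbsWeight hε hS hf hh)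
        (fun f h c hf hh => polyObs_add_mul hf hh c)
        hAK' hlin' hsymm' (fun φ => accScan_one hρ1 hK' φ)
        (fun f hf => polyObs_metroScan J lam hρ0 hρm hρmom hf)
        (fun f h c hf hh x => metroScan_add_mul_poly J lam hρ0 hρm hρmom hf hh c x)
        (fun f h hf hh => metroScan_reversible_poly hε hS hρ0 hρm hρi hρ1 hρs hρmom hf hh)
        (fun φ => metroScan_one J lam hρ1 φ)
        hv (polyObs_sq hv)
        (fun φ => accScan_carre_le_metroScan J lam hρ0 hρm hρmom hacc0 hacc1 haccDB hK' hv φ)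
      rw [one_mul] at h
      exact h)
    hg hP hsK hsM

end Lattice

end Summit.Ventures.LatticeQCDFlow.Exactness
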